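import Mathlib
import HarnessLib
import Summits.Ventures.LatticeQCDFlow.Exactness.IMHKernel

/-!
# Broadcasting ONE flow proposal to several replicas: every replica stays exact, the ensemble does NOT — the joint law drifts onto the diagonal,
# so the replicas' read-outs are individually unbiased but no longer independent

HONEST FRAMING: exact (Metropolis-corrected) sampling algorithms for lattice gauge theory;
figures of merit are autocorrelation/cost numbers at stated couplings and volumes; no
continuum-physics claim.

Venture `LatticeQCDFlow` (cell pub-lqcd), topic `Exactness`; FANOUT row 30 (lean-1, GEN-42).  NEW WORK of the cell (general state space, over
Mathlib and the tree's `IMHKernel`), the cautionary twin of this generation's `IMHCrossReplicaProposalExact`: there the replicas exchange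
INFORMATION (flows fitted on each other) and the product law stays invariant; here they share the PROPOSAL itself.  DEF-FREE: the two-replica
shared-proposal update is any Markov kernel `J` on `Ω × Ω` satisfying the displayed four-branch equation — propose ONE `y ∼ q`, and let each
replica accept it independently with its own Metropolis probability `a(x_i, y) = min(1, w(y)/w(x_i))`.

## Results (no `sorry`, no new definitions)
* `sharedProposal_branch_sum_fst` (the four branch weights seen through the first coordinate collapse to `a(x₁, y)·1_A(y) + (1 − a(x₁, y))·1_A(x₁)`),
  **`sharedProposal_apply_fst`** — `J((x₁, x₂), A × Ω) = indepMH q w (x₁, A)`: EACH REPLICA, SEEN ALONE, IS THE EXACT FLOW SAMPLER;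
  **`sharedProposal_fst_invariant`** — if the first marginal of the pair's law is `π = w·q`, it stays `π` after the shared update (and
  symmetrically for the second): MARGINAL EXACTNESS.
* `sharedProposal_apply_diagonal_ge` — from EVERY pair of states the update lands ON THE DIAGONAL `{x₁' = x₂'}` with probability at least
  `∫ a(x₁, y)a(x₂, y) q(dy) > 0` (both replicas accept the same proposal); **`sharedProposal_not_invariant`** — hence if `π ⊗ π` gives the
  diagonal mass zero (atomless `π`), `π ⊗ π` is NOT invariant: THE ENSEMBLE OF REPLICAS FED THE SAME PROPOSALS IS NOT AN EXACT SAMPLER OF THE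
  PRODUCT LAW, although each replica is exact.
Reading (gauge files): offering one batch of flow-generated gauge fields to many chains keeps every chain's expectation values unbiased but
correlates the chains (they coalesce on commonly accepted proposals); error bars computed as if the chains were independent replicas are
not certified — use independent proposals per chain, or the cross-replica scheme.  NOT CLAIMED: the size of the induced correlation; anything
for proposals shared across TIME (that is the common-random-numbers coupling of GEN-37–40, used there on purpose).
-/

noncomputable section

namespace Summit.Ventures.LatticeQCDFlow.Exactness

open MeasureTheory ProbabilityTheory
open scoped ENNReal

variable {Ω : Type*} [MeasurableSpace Ω] {q : Measure Ω} [IsProbabilityMeasure q] {w : Ω → ℝ}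

omit [MeasurableSpace Ω] in
/-- The four branch weights of the shared update, seen through a set `A × Ω` of the first coordinate, collapse to the single-replica
accept/reject integrand: `a₁a₂·1(y) + a₁(1 − a₂)·1(y) + (1 − a₁)a₂·1(x₁) + (1 − a₁)(1 − a₂)·1(x₁) = a₁·1_A(y) + (1 − a₁)·1_A(x₁)`. [ours, bookkeeping] -/
theorem sharedProposal_branch_sum_fst (hw0 : ∀ x, 0 < w x) (x₁ x₂ y : Ω) (A : Set Ω) :
    ENNReal.ofReal (imhAccept w x₁ y * imhAccept w x₂ y) * (A ×ˢ (Set.univ : Set Ω)).indicator 1 (y, y) +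
      ENNReal.ofReal (imhAccept w x₁ y * (1 - imhAccept w x₂ y)) * (A ×ˢ (Set.univ : Set Ω)).indicator 1 (y, x₂) +
      ENNReal.ofReal ((1 - imhAccept w x₁ y) * imhAccept w x₂ y) * (A ×ˢ (Set.univ : Set Ω)).indicator 1 (x₁, y) +
      ENNReal.ofReal ((1 - imhAccept w x₁ y) * (1 - imhAccept w x₂ y)) * (A ×ˢ (Set.univ : Set Ω)).indicator 1 (x₁, x₂) =
    imhAcceptE w x₁ y * A.indicator 1 y + (1 - imhAcceptE w x₁ y) * A.indicator 1 x₁ := by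
  have ha1 : 0 ≤ imhAccept w x₁ y := imhAccept_nonneg hw0 x₁ y
  have ha1' : imhAccept w x₁ y ≤ 1 := imhAccept_le_one w x₁ y
  have ha2 : 0 ≤ imhAccept w x₂ y := imhAccept_nonneg hw0 x₂ y
  have ha2' : imhAccept w x₂ y ≤ 1 := imhAccept_le_one w x₂ y
  have hind : ∀ u v : Ω, (A ×ˢ (Set.univ : Set Ω)).indicator (1 : Ω × Ω → ℝ≥0∞) (u, v) = A.indicator 1 u := fun u v => by
    by_cases hu : u ∈ A
    · rw [Set.indicator_of_mem (Set.mk_mem_prod hu (Set.mem_univ v)), Set.indicator_of_mem hu]; rfl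
    · rw [Set.indicator_of_notMem (fun h => hu (Set.mem_prod.1 h).1), Set.indicator_of_notMem hu]
  simp only [hind]
  have hE1 : (1 : ℝ≥0∞) - imhAcceptE w x₁ y = ENNReal.ofReal (1 - imhAccept w x₁ y) := by
    rw [imhAcceptE, ENNReal.ofReal_sub _ ha1, ENNReal.ofReal_one]
  rw [hE1, imhAcceptE]
  -- group the `y`-terms and the `x₁`-terms
  have hy : ENNReal.ofReal (imhAccept w x₁ y * imhAccept w x₂ y) + ENNReal.ofReal (imhAccept w x₁ y * (1 - imhAccept w x₂ y)) =
      ENNReal.ofReal (imhAccept w x₁ y) := by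
    rw [← ENNReal.ofReal_add (mul_nonneg ha1 ha2) (mul_nonneg ha1 (sub_nonneg.2 ha2'))]
    congr 1; ring
  have hx : ENNReal.ofReal ((1 - imhAccept w x₁ y) * imhAccept w x₂ y) + ENNReal.ofReal ((1 - imhAccept w x₁ y) * (1 - imhAccept w x₂ y)) =
      ENNReal.ofReal (1 - imhAccept w x₁ y) := by
    rw [← ENNReal.ofReal_add (mul_nonneg (sub_nonneg.2 ha1') ha2) (mul_nonneg (sub_nonneg.2 ha1') (sub_nonneg.2 ha2'))]
    congr 1; ring
  calc ENNReal.ofReal (imhAccept w x₁ y * imhAccept w x₂ y) * A.indicator 1 y +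
        ENNReal.ofReal (imhAccept w x₁ y * (1 - imhAccept w x₂ y)) * A.indicator 1 y +
        ENNReal.ofReal ((1 - imhAccept w x₁ y) * imhAccept w x₂ y) * A.indicator 1 x₁ +
        ENNReal.ofReal ((1 - imhAccept w x₁ y) * (1 - imhAccept w x₂ y)) * A.indicator 1 x₁
      = (ENNReal.ofReal (imhAccept w x₁ y * imhAccept w x₂ y) + ENNReal.ofReal (imhAccept w x₁ y * (1 - imhAccept w x₂ y))) * A.indicator 1 y +
        (ENNReal.ofReal ((1 - imhAccept w x₁ y) * imhAccept w x₂ y) + ENNReal.ofReal ((1 - imhAccept w x₁ y) * (1 - imhAccept w x₂ y))) *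
          A.indicator 1 x₁ := by ring
    _ = ENNReal.ofReal (imhAccept w x₁ y) * A.indicator 1 y + ENNReal.ofReal (1 - imhAccept w x₁ y) * A.indicator 1 x₁ := by rw [hy, hx]

/-- **EACH REPLICA ALONE IS THE EXACT FLOW SAMPLER**: `J((x₁, x₂), A × Ω) = indepMH q w (x₁, A)` for every measurable `A`. [ours] -/
theorem sharedProposal_apply_fst (hw : Measurable w) (hw0 : ∀ x, 0 < w x) (J : Kernel (Ω × Ω) (Ω × Ω))
    (hJ : ∀ (z : Ω × Ω) {S : Set (Ω × Ω)}, MeasurableSet S → J z S = ∫⁻ y,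
      (ENNReal.ofReal (imhAccept w z.1 y * imhAccept w z.2 y) * S.indicator 1 (y, y) +
        ENNReal.ofReal (imhAccept w z.1 y * (1 - imhAccept w z.2 y)) * S.indicator 1 (y, z.2) +
        ENNReal.ofReal ((1 - imhAccept w z.1 y) * imhAccept w z.2 y) * S.indicator 1 (z.1, y) +
        ENNReal.ofReal ((1 - imhAccept w z.1 y) * (1 - imhAccept w z.2 y)) * S.indicator 1 (z.1, z.2)) ∂q)
    (z : Ω × Ω) {A : Set Ω} (hA : MeasurableSet A) :
    J z (A ×ˢ (Set.univ : Set Ω)) = indepMH q w z.1 A := by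
  rw [hJ z (hA.prod MeasurableSet.univ)]
  simp_rw [sharedProposal_branch_sum_fst hw0 z.1 z.2 _ A]
  have ha : Measurable fun y => imhAcceptE w z.1 y := (measurable_imhAcceptE hw).of_uncurry_left
  rw [lintegral_add_left (show Measurable (fun y => imhAcceptE w z.1 y * A.indicator 1 y) from ha.mul (measurable_const.indicator hA)),
    lintegral_mul_const _ (show Measurable (fun y => 1 - imhAcceptE w z.1 y) from measurable_const.sub ha),
    indepMH_apply hw z.1 hA, imhAcceptMass]
  congr 1
  · rw [← lintegral_indicator hA]
    refine lintegral_congr fun y => ?_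
    by_cases hy : y ∈ A
    · rw [Set.indicator_of_mem hy, Set.indicator_of_mem hy, Pi.one_apply, mul_one]
    · rw [Set.indicator_of_notMem hy, Set.indicator_of_notMem hy, mul_zero]
  · have hfin : ∫⁻ y, imhAcceptE w z.1 y ∂q ≠ ⊤ := ne_top_of_le_ne_top ENNReal.one_ne_top (imhAcceptMass_le_one q w z.1)
    rw [lintegral_sub ha hfin (ae_of_all _ fun y => imhAcceptE_le_one w z.1 y), lintegral_const, measure_univ, mul_one]

/-- **MARGINAL EXACTNESS**: if the pair's law `μ` has first marginal `π = w·q`, then so does `μJ`. [ours] -/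
theorem sharedProposal_fst_invariant (hw : Measurable w) (hw0 : ∀ x, 0 < w x) (J : Kernel (Ω × Ω) (Ω × Ω))
    (hJ : ∀ (z : Ω × Ω) {S : Set (Ω × Ω)}, MeasurableSet S → J z S = ∫⁻ y,
      (ENNReal.ofReal (imhAccept w z.1 y * imhAccept w z.2 y) * S.indicator 1 (y, y) +
        ENNReal.ofReal (imhAccept w z.1 y * (1 - imhAccept w z.2 y)) * S.indicator 1 (y, z.2) +
        ENNReal.ofReal ((1 - imhAccept w z.1 y) * imhAccept w z.2 y) * S.indicator 1 (z.1, y) +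
        ENNReal.ofReal ((1 - imhAccept w z.1 y) * (1 - imhAccept w z.2 y)) * S.indicator 1 (z.1, z.2)) ∂q)
    (μ : Measure (Ω × Ω)) (hμ : μ.map Prod.fst = q.withDensity fun x => ENNReal.ofReal (w x)) :
    (μ.bind J).map Prod.fst = q.withDensity fun x => ENNReal.ofReal (w x) := by
  ext A hA
  rw [Measure.map_apply measurable_fst hA, Measure.bind_apply (measurable_fst hA) (Kernel.aemeasurable _)]
  have hset : (Prod.fst ⁻¹' A : Set (Ω × Ω)) = A ×ˢ (Set.univ : Set Ω) := by ext p; simp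
  simp_rw [hset, sharedProposal_apply_fst hw hw0 J hJ _ hA]
  have hK : Measurable fun x : Ω => indepMH q w x A := Kernel.measurable_coe _ hA
  rw [← lintegral_map hK measurable_fst, hμ]
  have hinv := (indepMH_invariant (q := q) hw hw0).def
  have := congrArg (fun ν : Measure Ω => ν A) hinv
  rwa [Measure.bind_apply hA (Kernel.aemeasurable _)] at this

omit [IsProbabilityMeasure q] in
/-- **BOTH REPLICAS ACCEPT THE SAME PROPOSAL WITH POSITIVE PROBABILITY**: from every pair of states the shared update lands on the diagonal with
probability at least `∫ a(x₁, y)·a(x₂, y) q(dy)`. [ours] -/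
theorem sharedProposal_apply_diagonal_ge (J : Kernel (Ω × Ω) (Ω × Ω))
    (hJ : ∀ (z : Ω × Ω) {S : Set (Ω × Ω)}, MeasurableSet S → J z S = ∫⁻ y,
      (ENNReal.ofReal (imhAccept w z.1 y * imhAccept w z.2 y) * S.indicator 1 (y, y) +
        ENNReal.ofReal (imhAccept w z.1 y * (1 - imhAccept w z.2 y)) * S.indicator 1 (y, z.2) +
        ENNReal.ofReal ((1 - imhAccept w z.1 y) * imhAccept w z.2 y) * S.indicator 1 (z.1, y) +
        ENNReal.ofReal ((1 - imhAccept w z.1 y) * (1 - imhAccept w z.2 y)) * S.indicator 1 (z.1, z.2)) ∂q)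
    (hΔ : MeasurableSet {p : Ω × Ω | p.1 = p.2}) (z : Ω × Ω) :
    ∫⁻ y, ENNReal.ofReal (imhAccept w z.1 y * imhAccept w z.2 y) ∂q ≤ J z {p : Ω × Ω | p.1 = p.2} := by
  rw [hJ z hΔ]
  refine lintegral_mono fun y => ?_
  have hmem : (y, y) ∈ ({p : Ω × Ω | p.1 = p.2} : Set (Ω × Ω)) := rfl
  have h1 : ({p : Ω × Ω | p.1 = p.2} : Set (Ω × Ω)).indicator (1 : Ω × Ω → ℝ≥0∞) (y, y) = 1 := by
    rw [Set.indicator_of_mem hmem]; rfl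
  rw [h1, mul_one]
  calc ENNReal.ofReal (imhAccept w z.1 y * imhAccept w z.2 y)
      ≤ ENNReal.ofReal (imhAccept w z.1 y * imhAccept w z.2 y) +
          ENNReal.ofReal (imhAccept w z.1 y * (1 - imhAccept w z.2 y)) * ({p : Ω × Ω | p.1 = p.2} : Set (Ω × Ω)).indicator 1 (y, z.2) :=
        le_self_add
    _ ≤ ENNReal.ofReal (imhAccept w z.1 y * imhAccept w z.2 y) +
          ENNReal.ofReal (imhAccept w z.1 y * (1 - imhAccept w z.2 y)) * ({p : Ω × Ω | p.1 = p.2} : Set (Ω × Ω)).indicator 1 (y, z.2) +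
          ENNReal.ofReal ((1 - imhAccept w z.1 y) * imhAccept w z.2 y) * ({p : Ω × Ω | p.1 = p.2} : Set (Ω × Ω)).indicator 1 (z.1, y) :=
        le_self_add
    _ ≤ _ := le_self_add

/-- **… SO THE PRODUCT LAW IS NOT INVARIANT** whenever it gives the diagonal mass zero (e.g. `π` atomless): the ensemble of replicas fed the
same flow proposals is NOT an exact sampler of `π ⊗ π`, although each replica is an exact sampler of `π`. [ours] -/
theorem sharedProposal_not_invariant (hw : Measurable w) (hw0 : ∀ x, 0 < w x) (J : Kernel (Ω × Ω) (Ω × Ω))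
    (hJ : ∀ (z : Ω × Ω) {S : Set (Ω × Ω)}, MeasurableSet S → J z S = ∫⁻ y,
      (ENNReal.ofReal (imhAccept w z.1 y * imhAccept w z.2 y) * S.indicator 1 (y, y) +
        ENNReal.ofReal (imhAccept w z.1 y * (1 - imhAccept w z.2 y)) * S.indicator 1 (y, z.2) +
        ENNReal.ofReal ((1 - imhAccept w z.1 y) * imhAccept w z.2 y) * S.indicator 1 (z.1, y) +
        ENNReal.ofReal ((1 - imhAccept w z.1 y) * (1 - imhAccept w z.2 y)) * S.indicator 1 (z.1, z.2)) ∂q)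
    (hΔ : MeasurableSet {p : Ω × Ω | p.1 = p.2}) (μ : Measure (Ω × Ω)) (hμ0 : μ ≠ 0) (hμΔ : μ {p : Ω × Ω | p.1 = p.2} = 0) :
    ¬ Kernel.Invariant J μ := by
  intro hinv
  have h := congrArg (fun ν : Measure (Ω × Ω) => ν {p : Ω × Ω | p.1 = p.2}) hinv.def
  rw [Measure.bind_apply hΔ (Kernel.aemeasurable _), hμΔ] at h
  -- the integrand is bounded below by a positive function, so the integral is positive
  have hpos : ∀ z : Ω × Ω, 0 < ∫⁻ y, ENNReal.ofReal (imhAccept w z.1 y * imhAccept w z.2 y) ∂q := fun z => by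
    have hmeas_y : Measurable fun y => ENNReal.ofReal (imhAccept w z.1 y * imhAccept w z.2 y) := by
      have heq : (fun y => ENNReal.ofReal (imhAccept w z.1 y * imhAccept w z.2 y)) = fun y => imhAcceptE w z.1 y * imhAcceptE w z.2 y := by
        funext y; rw [imhAcceptE, imhAcceptE, ← ENNReal.ofReal_mul (imhAccept_nonneg hw0 _ _)]
      rw [heq]
      exact (measurable_imhAcceptE hw).of_uncurry_left.mul (measurable_imhAcceptE hw).of_uncurry_left
    rw [lintegral_pos_iff_support hmeas_y]
    have hsupp : Function.support (fun y => ENNReal.ofReal (imhAccept w z.1 y * imhAccept w z.2 y)) = Set.univ :=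
      Set.eq_univ_of_forall fun y => (ENNReal.ofReal_pos.2 (mul_pos
        (by unfold imhAccept; exact lt_min one_pos (div_pos (hw0 y) (hw0 z.1)))
        (by unfold imhAccept; exact lt_min one_pos (div_pos (hw0 y) (hw0 z.2))))).ne'
    rw [hsupp, measure_univ]; exact one_pos
  have hle : ∫⁻ z, ∫⁻ y, ENNReal.ofReal (imhAccept w z.1 y * imhAccept w z.2 y) ∂q ∂μ ≤ ∫⁻ z, J z {p : Ω × Ω | p.1 = p.2} ∂μ :=
    lintegral_mono fun z => sharedProposal_apply_diagonal_ge J hJ hΔ z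
  rw [h] at hle
  have hzero : ∫⁻ z, ∫⁻ y, ENNReal.ofReal (imhAccept w z.1 y * imhAccept w z.2 y) ∂q ∂μ = 0 := le_antisymm hle bot_le
  have hmeas : Measurable fun z : Ω × Ω => ∫⁻ y, ENNReal.ofReal (imhAccept w z.1 y * imhAccept w z.2 y) ∂q := by
    have h2 : Measurable (Function.uncurry fun (z : Ω × Ω) (y : Ω) => ENNReal.ofReal (imhAccept w z.1 y * imhAccept w z.2 y)) := by
      unfold imhAccept
      exact ((measurable_const.min ((hw.comp measurable_snd).div (hw.comp (measurable_fst.comp measurable_fst)))).mul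
        (measurable_const.min ((hw.comp measurable_snd).div (hw.comp (measurable_snd.comp measurable_fst))))).ennreal_ofReal
    exact h2.lintegral_prod_right'
  rw [lintegral_eq_zero_iff hmeas] at hzero
  have hae : ∀ᵐ z ∂μ, False := hzero.mono fun z hz => (hpos z).ne' hz
  rw [Filter.eventually_false_iff_eq_bot, ae_eq_bot] at hae
  exact hμ0 hae

end Summit.Ventures.LatticeQCDFlow.Exactness
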